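import Mathlib
import Literature.RingTheory.MvPolynomial.GrobnerDegeneration
import Literature.RingTheory.MvPolynomial.LeadingExponents
import Summits.ResolutionOfSingularities.ResolutionOfSingularities.Theorems.TropicalLinksSchonResolvesMapCSlice

/-!
# TropicalLinks / SchonResolves — standard monomials are `k[t]`-independent modulo the
# Gröbner degeneration ideal

Route `ResolutionOfSingularities/TropicalLinks`, crux `SchonResolves`
(stmt-ResolutionOfSingularities-17234), line `zariski-toric-closure`, the INDEPENDENCE half of
KERNEL (P1) ("inside a Gröbner cone the Gröbner degeneration `k[t][x] ⧸ grobnerDegeneration W I`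
is free over `k[t] = MvPolynomial ι k` with basis the standard monomials `{x^a : a ∉ E_m(I)}`",
Eisenbud, *Commutative Algebra*, §15.8, Thm. 15.17; several weights as in Maclagan–Sturmfels
§2.4–2.5).  Independence needs no cone hypothesis; the tool is the SHEAR
`Φ : x^a ↦ t^{W·a} x^a`, the `k[t]`-algebra endomorphism
`MvPolynomial.aeval (fun s => C (t^{W_s}) * X s)` of `k[t][x]` (`(W·a)_i = ⟨W i, a⟩`):

* `schonResolves_shear_monomial`, `schonResolves_coeff_shear` — `Φ (r·x^a) = (t^{W·a} r)·x^a`,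
  `[x^a] Φ g = t^{W·a} · [x^a] g`;
* `schonResolves_shear_twist` — `Φ (twist W f) = t^{μ(f)} · f` for `f ∈ k[x]`
  (`twistExponent + W·a = μ(f)` on the support);
* `schonResolves_aeval_shear_mem_map_of_mem_grobnerDegeneration` (registered stub) — **`Φ` maps
  the degeneration ideal into the extended ideal `I^e = I.map (map C)`** (twists go to
  `t^{μ} f ∈ I^e`, and `I^e` is saturated with respect to `∏ tᵢ`);
* `schonResolves_grobnerDegeneration_standard_independent` (registered stub) — **a
  `k[t]`-combination `Σ_a c_a x^a` of standard monomials lying in `grobnerDegeneration W I`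
  is trivial**: every `t`-slice of `Φ (Σ_a c_a x^a) ∈ I^e` is a member of `I` supported on
  standard monomials, hence zero (the leading exponent of a non-zero member of `I` lies in
  `E_m(I)`), so all `t^{W·a} c_a` vanish.

No new definitions.
-/

-- single-problem summit: the doubled namespace component `ResolutionOfSingularities` is forced
set_option linter.dupNamespace false

namespace Summit.ResolutionOfSingularities.ResolutionOfSingularities.Theorems

open MvPolynomial Finsupp Literature.RingTheory.MvPolynomial

section StandardIndependent

variable {k : Type} [Field k] {σ ι : Type} [Fintype ι] (W : ι → σ → ℕ)

/-- **The shear on a term**: `Φ (r · x^a) = (t^{W·a} · r) · x^a` for `r ∈ k[t]`, where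
`(W·a)_i = ⟨W i, a⟩ = Finsupp.weight (W i) a`. [folklore] -/
theorem schonResolves_shear_monomial (a : σ →₀ ℕ) (r : MvPolynomial ι k) :
    aeval (fun s : σ => C (monomial (equivFunOnFinite.symm fun i => W i s) (1 : k)) * X s)
        (monomial a r) =
      monomial a (monomial (equivFunOnFinite.symm fun i => weight (W i) a) (1 : k) * r) := by
  have hXs : ∀ s : σ, C (monomial (equivFunOnFinite.symm fun i => W i s) (1 : k)) * X s =
      monomial (Finsupp.single s 1)
        (monomial (equivFunOnFinite.symm fun i => W i s) (1 : k)) := by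
    intro s
    rw [X, C_mul_monomial, mul_one]
  have hsum : (∑ s ∈ a.support, a s • Finsupp.single s 1) = a := by
    simp only [smul_single_one]; exact a.sum_single
  have hv : (∑ s ∈ a.support, a s • (equivFunOnFinite.symm fun i => W i s : ι →₀ ℕ)) =
      equivFunOnFinite.symm fun i => weight (W i) a := by
    ext i
    simp [Finsupp.finsetSum_apply, weight_apply, Finsupp.sum]
  simp_rw [hXs]
  rw [aeval_monomial, algebraMap_eq]
  simp only [monomial_pow, one_pow]
  rw [Finsupp.prod, ← monomial_sum_prod, ← monomial_sum_one, C_mul_monomial, mul_comm r, hsum,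
    hv]

/-- **The coefficients of the shear**: `[x^a] Φ g = t^{W·a} · [x^a] g`. [folklore] -/
theorem schonResolves_coeff_shear (g : MvPolynomial σ (MvPolynomial ι k)) (a : σ →₀ ℕ) :
    coeff a (aeval
        (fun s : σ => C (monomial (equivFunOnFinite.symm fun i => W i s) (1 : k)) * X s) g) =
      monomial (equivFunOnFinite.symm fun i => weight (W i) a) (1 : k) * coeff a g := by
  classical
  conv_lhs => rw [g.as_sum, map_sum, coeff_sum]
  simp only [schonResolves_shear_monomial, coeff_monomial, Finset.sum_ite_eq']
  split_ifs with h
  · rfl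
  · rw [MvPolynomial.notMem_support_iff.mp h, mul_zero]

/-- **The shear of a twist**: `Φ (twist W f) = t^{μ(f)} · f` for `f ∈ k[x]`, where
`μ(f)_i = max_{b ∈ supp f} ⟨W i, b⟩` (on the support `twistExponent W f a + W·a = μ(f)`).
[folklore] -/
theorem schonResolves_shear_twist (f : MvPolynomial σ k) :
    aeval (fun s : σ => C (monomial (equivFunOnFinite.symm fun i => W i s) (1 : k)) * X s)
        (twist W f) =
      C (monomial (equivFunOnFinite.symm fun i => weightedTotalDegree (W i) f) (1 : k)) *
        MvPolynomial.map (C : k →+* MvPolynomial ι k) f := by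
  classical
  refine MvPolynomial.ext _ _ fun a => ?_
  rw [schonResolves_coeff_shear, coeff_twist, coeff_C_mul, coeff_map, monomial_mul, one_mul,
    C_apply, monomial_mul, add_zero, one_mul]
  by_cases ha : a ∈ f.support
  · congr 2
    ext i
    simpa using add_tsub_cancel_of_le (le_weightedTotalDegree (W i) ha)
  · rw [MvPolynomial.notMem_support_iff.mp ha, map_zero, map_zero]

/-- The shear maps the ideal generated by the twists of the members of `I` into the extended
ideal `I^e = I.map (map C)` (each `Φ (twist W f) = t^{μ(f)} f` lies in `I^e`). [folklore] -/
theorem schonResolves_shear_mem_map_of_mem_span_twist (I : Ideal (MvPolynomial σ k))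
    {g : MvPolynomial σ (MvPolynomial ι k)}
    (hg : g ∈ Ideal.span (twist W '' (I : Set (MvPolynomial σ k)))) :
    aeval (fun s : σ => C (monomial (equivFunOnFinite.symm fun i => W i s) (1 : k)) * X s) g ∈
      I.map (MvPolynomial.map (C : k →+* MvPolynomial ι k)) := by
  induction hg using Submodule.span_induction with
  | mem x hx =>
    obtain ⟨f, hf, rfl⟩ := hx
    rw [schonResolves_shear_twist]
    exact Ideal.mul_mem_left _ _ (Ideal.mem_map_of_mem _ hf)
  | zero => rw [map_zero]; exact Ideal.zero_mem _
  | add x y _ _ hx hy => rw [map_add]; exact Ideal.add_mem _ hx hy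
  | smul r x _ hx => rw [smul_eq_mul, map_mul]; exact Ideal.mul_mem_left _ _ hx

/-- **The shear maps the Gröbner degeneration ideal into the extended ideal**: for
`g ∈ grobnerDegeneration W I` (i.e. `g · (∏ tᵢ)^M ∈ ⟨twist W f : f ∈ I⟩` for some
`M`), `Φ g ∈ I^e = I.map (map C)`, where `Φ = aeval (fun s => C (t^{W_s}) * X s)` is the shear
`x^a ↦ t^{W·a} x^a`: `Φ` fixes `k[t]`, sends `twist W f` to `t^{μ(f)} f ∈ I^e`, and `I^e` is
saturated with respect to `∏ tᵢ`. [cite: Eisenbud1995, §15.8, Thm. 15.17 (proof)] -/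
theorem schonResolves_aeval_shear_mem_map_of_mem_grobnerDegeneration : ∀ (k : Type) [Field k]
    (σ ι : Type) [Fintype ι] [DecidableEq ι] (W : ι → σ → ℕ)
    (I : Ideal (MvPolynomial σ k)) (g : MvPolynomial σ (MvPolynomial ι k)),
    g ∈ Literature.RingTheory.MvPolynomial.grobnerDegeneration W I →
      MvPolynomial.aeval (fun s : σ => MvPolynomial.C (MvPolynomial.monomial
        (Finsupp.equivFunOnFinite.symm fun i => W i s) (1 : k)) * MvPolynomial.X s) g ∈
        I.map (MvPolynomial.map (MvPolynomial.C : k →+* MvPolynomial ι k)) := by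
  intro k _ σ ι _ _ W I g hg
  obtain ⟨M, hM⟩ := hg
  have h := schonResolves_shear_mem_map_of_mem_span_twist W I hM
  rw [map_mul, map_pow, aeval_C, algebraMap_eq] at h
  exact schonResolves_mem_map_map_C_of_mul_C_prod_X_pow_mem I M h

/-- **Standard monomials are `k[t]`-independent modulo the Gröbner degeneration ideal**
(independence half of Eisenbud 15.17 / KERNEL (P1), valid for arbitrary natural weights): if a
finite `k[t]`-combination `Σ_a c_a x^a` of standard monomials (`a ∉ E_m(I)`, the leading
exponents of `I` for a monomial order `m`) lies in `grobnerDegeneration W I`, then `c = 0`.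
Proof: the shear `Φ` puts it in `I^e` with `[x^a] Φ(Σ c_a x^a) = t^{W·a} c_a`; every `t`-slice
of a member of `I^e` is a member of `I`, here supported on standard monomials, hence zero since
the leading exponent of a non-zero member of `I` lies in `E_m(I)`; so all `t^{W·a} c_a` vanish.
[cite: Eisenbud1995, §15.8, Thm. 15.17] -/
theorem schonResolves_grobnerDegeneration_standard_independent : ∀ (k : Type) [Field k]
    (σ ι : Type) [Fintype ι] [DecidableEq ι] (W : ι → σ → ℕ) (m : MonomialOrder σ)
    (I : Ideal (MvPolynomial σ k)) (c : (σ →₀ ℕ) →₀ MvPolynomial ι k),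
    (∀ a ∈ c.support, a ∉ Literature.RingTheory.MvPolynomial.leadingExponents m I) →
      (∑ a ∈ c.support, MvPolynomial.monomial a (c a)) ∈
        Literature.RingTheory.MvPolynomial.grobnerDegeneration W I → c = 0 := by
  intro k _ σ ι _ _ W m I c hc hmem
  classical
  have hΦ := schonResolves_aeval_shear_mem_map_of_mem_grobnerDegeneration k σ ι W I _ hmem
  rw [schonResolves_mem_map_map_C_iff_commAlgEquiv, mem_map_C_iff] at hΦ
  have hcoeff : ∀ a, coeff a (∑ b ∈ c.support, monomial b (c b)) = c a := by
    intro a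
    rw [coeff_sum]
    simp only [coeff_monomial, Finset.sum_ite_eq']
    split_ifs with h
    · rfl
    · exact (Finsupp.notMem_support_iff.mp h).symm
  -- every `t`-slice of `Φ (Σ c_a x^a)` vanishes
  have hzero : ∀ e, coeff e (commAlgEquiv k σ ι
      (aeval (fun s : σ => C (monomial (equivFunOnFinite.symm fun i => W i s) (1 : k)) * X s)
        (∑ a ∈ c.support, MvPolynomial.monomial a (c a)))) = 0 := by
    intro e
    by_contra hne
    have hsupp := m.coeff_degree_ne_zero_iff.mpr hne
    rw [schonResolves_coeff_coeff_commAlgEquiv, schonResolves_coeff_shear, hcoeff] at hsupp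
    refine hc _ ?_ ⟨_, hΦ e, hne, rfl⟩
    rw [Finsupp.mem_support_iff]
    intro h0
    rw [h0, mul_zero, coeff_zero] at hsupp
    exact hsupp rfl
  refine Finsupp.ext fun a => MvPolynomial.ext _ _ fun e => ?_
  have h1 := congrArg (coeff a) (hzero (equivFunOnFinite.symm (fun i => weight (W i) a) + e))
  rw [schonResolves_coeff_coeff_commAlgEquiv, coeff_zero, schonResolves_coeff_shear, hcoeff,
    coeff_monomial_mul, one_mul] at h1
  rw [h1, Finsupp.coe_zero, Pi.zero_apply, coeff_zero]

end StandardIndependent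

end Summit.ResolutionOfSingularities.ResolutionOfSingularities.Theorems
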